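import Summits.BirchSwinnertonDyer.BirchSwinnertonDyer.Theorems.ByReductionTypeAtTwoTorsionEulerCharH46BadPlaces
import Summits.BirchSwinnertonDyer.BirchSwinnertonDyer.Theorems.ByReductionTypeAtTwoTorsionEulerCharH46LevelZeroInputs
import HarnessLib

/-!
# H46 kernel programme (road C′), brick R2 of `NOTE-B6-SCHEDULE-GEN38` §4: «layer-`n` Selmer membership» — the pushed ♭-class
# `h_n (push b) ∈ H¹(ℚ_∞, E[p^∞])`, up to a UNIFORM power of `p`, is Selmer over `ℚ_∞`

Cell `bsd-2adic` (run/shared/lean/pub/bsd-2adic/), seat `bsd-2adic-tower-1` GEN 39; `--supports stmt-BirchSwinnertonDyer-19271`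
(helper, item `OrdKatoHalfAtTwo`, TOWER road). THEOREMS ONLY (no definition, no named fact, no instance, no `sorry`); closes no item;
nothing booked; BSD is not proved by any of this.

The schedule theorem `TorsionEulerChar.B6.exists_layer_cores_reduce_eq_zero` (GEN 38) delivers the socket (HB6) of the H46 assembly at a
deep layer `n*` for every layer class `b ∈ H¹(Γ_{n*}, E[p^N])` such that `p^{c'} · h_{n*}(push b) ∈ Sel_{p^∞}(E/ℚ_∞)` for a `c'`
independent of `N` and `b`. This file proves that membership for the ♭-dual classes of the levelwise Poitou–Tate call made with `Sp = S`
(NOTE §4 R2): such a `b` is UNRAMIFIED (its Shapiro lift is) at every finite `w ≠ v₀` with `w ∤ p` — good or bad — and STRICT at `p`,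
and FREE at the auxiliary place `v₀` and at `∞`.

* §1 `pow_nsmul_localH1_eq_zero_of_forall_mem` — GEN 35's layer-`0` exponent lemma for an ARBITRARY `H ≤ Γ_ℚ` whose local subgroup at the
  `ℚ`-field `E` is everything (`∀ τ, τ ∈ localSubgroup H E`): a `p`-power-torsion class of `H¹(localSubgroup H E, E(Ē))` is killed by the
  uniform power `p^{N_w}` of `GaloisImage.exists_pow_smul_eq_zero_galoisCohomology_localGaloisModule`.
* §1 `mem_localSubgroup_layerSubgroup_infinitePlace` — at an infinite place EVERY local element lies in the local subgroup of every layer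
  (`Γ_{ℚ_w}` is finite and `ℤ_p` is torsion free, so `D_w ≤ ker κ ≤ Γ_n`).
* §2 **`exists_pow_nsmul_push_mem_selmerInfty`** — `W/ℚ` globally minimal elliptic, `p` prime of GOOD reduction (`vp ∋ p`), `κ` cyclotomic,
  `n` a layer and `v₀ ∤ p` a finite place SPLIT in `ℚ_n` (`localSubgroup (κ.layerSubgroup n) ℚ_{v₀} = ⊤`). There is `c'` such that for
  every level `N` and every `b ∈ H¹(Γ_n, E[p^N])` which is unramified at every finite `w ≠ v₀`, `w ∤ p` and strict at `vp`:
  **`p^{c'} · h_n (push b) ∈ W.selmerInfty κ`**. Place by place, for every conjugate: `vp` — Greenberg strict ⟹ Kummer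
  (`H46AtP.conjH1_realiser_mem_localKerOver_of_mem_strictKer`); `w ∤ p`, `w ≠ v₀` — unramified ⟹ Kummer over `ℚ_∞` with NO reduction
  hypothesis (`H46BadPlaces.conjH1_realiser_mem_localKerOver_of_localization_shapiroLift_mem_unramified_of_not_mem`); `v₀` and `∞` — the local
  subgroup of the layer is everything, so the layer-`0` exponent argument applies verbatim (`p^{N_{v₀}}`, resp. `#H¹(ℚ_w, E)`), through
  `conj_σ ∘ h_n = h_n ∘ conj_σ` (`layerToInfty_conjH1`) and `p^N · push b = 0`; `c' = v_p(p^{N_{v₀}} · ∏_w #H¹(ℚ_w, E))`.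

References: [GreenbergLNM1716] §2 (p. 70), Prop. 2.4, §4 Lemma 4.6 (p. 105); [MilneADT2006] I Cor. 3.4, Thm. 2.13.
-/

set_option autoImplicit false
-- the Theorems namespace of this sub repeats the summit name by design (D-0017 nested layout)
set_option linter.dupNamespace false

noncomputable section

open scoped Classical NumberField

namespace Summit.BirchSwinnertonDyer.BirchSwinnertonDyer.Theorems

namespace TorsionEulerChar.H46LayerSelmer

open CategoryTheory Field NumberField IsDedekindDomain WeierstrassCurve
  Literature.NumberTheory.EllipticCurves Literature.NumberTheory.EllipticCurves.CyclotomicLayer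
  Literature.NumberTheory.EllipticCurves.GreenbergSelmer
  Literature.NumberTheory.GaloisRepresentations Literature.NumberTheory.GaloisRepresentations.DiscreteGaloisModule
  Literature.NumberTheory.GaloisCohomology ZpExtension

/-! ## §1 Local subgroups that are everything: the split auxiliary place and the infinite places -/

section Local

variable (W : WeierstrassCurve ℚ) (p : ℕ) [hp : Fact p.Prime] (κ : ZpExtension ℚ p)

omit hp in
/-- **The uniform local exponent at a place whose local subgroup is everything.** For `H ≤ Γ_ℚ` and a `ℚ`-field `E` with
`localSubgroup H E = Γ_E` (every `τ`), a `p`-power-torsion class of `H¹(localSubgroup H E, E(Ē))` is killed by any power `p^{N_w}` killing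
the `p`-power torsion of `H¹(Γ_E, E(Ē))` (transport along the bijective restriction `H¹(Γ_E, ·) → H¹(localSubgroup H E, ·)`). GEN 35's
`H46LevelZero.pow_nsmul_localH1_layerZero_eq_zero` is the case `H = Γ_0`. [cite: MilneADT2006, Ch. I, Cor. 3.4] -/
theorem pow_nsmul_localH1_eq_zero_of_forall_mem (E : Type) [Field E] [Algebra ℚ E] (H : Subgroup (absoluteGaloisGroup ℚ))
    (hall : ∀ τ : absoluteGaloisGroup E, τ ∈ localSubgroup H E) {Nw : ℕ}
    (hNw : ∀ c : galoisCohomology (W.localGaloisModule E) 1, (∃ j : ℕ, ((p ^ j : ℕ) : ℤ) • c = 0) → ((p ^ Nw : ℕ) : ℤ) • c = 0)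
    (x : discreteH1 (localSubgroup H E) (localPoints W E)) {j : ℕ} (hx : p ^ j • x = 0) :
    p ^ Nw • x = 0 := by
  have hbij := bijective_resH1Hom_subgroupIncl (localPoints W E) (localSubgroup H E) hall
  obtain ⟨y, rfl⟩ := hbij.2 x
  have hy : p ^ j • y = 0 := hbij.1 (by rw [map_nsmul, hx, map_zero])
  have hy' := hNw y ⟨j, by rw [natCast_zsmul]; exact hy⟩
  rw [natCast_zsmul] at hy'
  have hy'' : p ^ Nw • y = 0 := hy'
  rw [← map_nsmul]
  exact (congrArg _ hy'').trans (map_zero _)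

/-- **At an infinite place every local element lies in the local subgroup of every layer**: `Γ_{ℚ_w}` is finite, so `κ(τ|_{ℚ̄})` is
torsion in the torsion-free `ℤ_p`, i.e. `τ|_{ℚ̄} ∈ ker κ ≤ Γ_n` (every layer `ℚ_n` is real). [cite: Washington1997, §13.1]
[cite: SerreGaloisCohomology1997, I §2.4] -/
theorem mem_localSubgroup_layerSubgroup_infinitePlace (n : ℕ) (w : InfinitePlace ℚ) (τ : absoluteGaloisGroup w.Completion) :
    τ ∈ localSubgroup (κ.layerSubgroup n) w.Completion := by
  rw [mem_localSubgroup_iff]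
  refine κ.kerSubgroup_le_layerSubgroup n ?_
  haveI := finite_absoluteGaloisGroup_completion_infinitePlace w
  have hm0 : Nat.card (absoluteGaloisGroup w.Completion) ≠ 0 := Nat.card_pos.ne'
  have hτ : τ ^ Nat.card (absoluteGaloisGroup w.Completion) = 1 := pow_card_eq_one'
  rw [ZpExtension.mem_kerSubgroup]
  apply Multiplicative.toAdd.injective
  rw [toAdd_one]
  have h1 : Nat.card (absoluteGaloisGroup w.Completion) • (κ (resGal (K := ℚ) w.Completion τ)).toAdd = 0 := by
    rw [← toAdd_pow, ← map_pow, ← map_pow, hτ, map_one, map_one, toAdd_one]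
  rw [nsmul_eq_mul, mul_eq_zero] at h1
  exact h1.resolve_left (Nat.cast_ne_zero.mpr hm0)

end Local

/-! ## §2 The pushed ♭-class is Selmer over `ℚ_∞` up to a uniform power of `p` -/

section Main

variable (W : WeierstrassCurve ℚ) [W.IsElliptic] (p : ℕ) [hp : Fact p.Prime] (κ : ZpExtension ℚ p)
  (hκ : κ.IsCyclotomic) (n : ℕ) (v₀ : HeightOneSpectrum (𝓞 ℚ)) (hpv₀ : ((p : ℕ) : 𝓞 ℚ) ∉ v₀.asIdeal)
  (hsplit : localSubgroup (κ.layerSubgroup n) (v₀.adicCompletion ℚ) = ⊤)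
  (vp : HeightOneSpectrum (𝓞 ℚ)) (hvp : ((p : ℕ) : 𝓞 ℚ) ∈ vp.asIdeal) (hgoodp : W.HasGoodReductionAt vp)

include hκ hpv₀ hsplit hvp hgoodp in
/-- **R2: layer-`n` Selmer membership of the pushed ♭-classes.** `W/ℚ` elliptic, `p` of GOOD reduction (`vp ∋ p`), `κ` cyclotomic, `n` a
layer, `v₀ ∤ p` split in `ℚ_n` (`localSubgroup (κ.layerSubgroup n) ℚ_{v₀} = ⊤`). There is `c'` such that for every level `N`, every
transversal `s` (`s(1) = 1`) and every `b ∈ H¹(Γ_n, E[p^N])` whose Shapiro lift is UNRAMIFIED at every finite `w ≠ v₀` with `w ∤ p` and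
which is STRICT at `vp`: `p^{c'} · h_n (push b) ∈ Sel_{p^∞}(E/ℚ_∞)`. See the module docstring for the place-by-place argument; `c'` depends on
`W, p, v₀` only (`v_p` of `p^{N_{v₀}} · ∏_{w ∣ ∞} #H¹(ℚ_w, E)`). [cite: GreenbergLNM1716, §2 (p. 70), Prop. 2.4, §4 Lemma 4.6 (p. 105)]
[cite: MilneADT2006, Ch. I, Cor. 3.4] -/
theorem exists_pow_nsmul_push_mem_selmerInfty :
    ∃ c' : ℕ, ∀ (N : ℕ) [Fintype (absoluteGaloisGroup ℚ ⧸ κ.layerSubgroup n)]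
      {s : absoluteGaloisGroup ℚ ⧸ κ.layerSubgroup n → absoluteGaloisGroup ℚ}
      (hs : ∀ x : absoluteGaloisGroup ℚ ⧸ κ.layerSubgroup n, (s x : absoluteGaloisGroup ℚ ⧸ κ.layerSubgroup n) = x)
      (hs1 : s ((1 : absoluteGaloisGroup ℚ) : absoluteGaloisGroup ℚ ⧸ κ.layerSubgroup n) = 1)
      (b : W.torsionH1Over ((p : ℤ) ^ N) (κ.layerSubgroup n)),
      (∀ w : HeightOneSpectrum (𝓞 ℚ), w ≠ v₀ → ((p : ℕ) : 𝓞 ℚ) ∉ w.asIdeal →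
        galoisCohomology.localization ((W.torsionGaloisModule ((p : ℤ) ^ N)).coind (κ.layerSubgroup n) (κ.isOpen_layerSubgroup n))
            (Sum.inr w) 1
            (shapiroLift (W.torsionGaloisModule ((p : ℤ) ^ N)).toTopRep (κ.layerSubgroup n) (κ.isOpen_layerSubgroup n) hs hs1 b) ∈
          unramifiedSubgroup (GaloisRep.toLocal w
            ((W.torsionGaloisModule ((p : ℤ) ^ N)).coind (κ.layerSubgroup n) (κ.isOpen_layerSubgroup n))) 1) →
      b ∈ (W.kernelOfReductionLocalDatumTorsion ((p : ℤ) ^ N) vp).strictKer (κ.layerSubgroup n) →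
      p ^ c' • W.layerToInfty κ n (resH1Hom (N := W.geomPrimaryTorsion p) (subgroupInclusion (le_refl (κ.layerSubgroup n)))
          (AddSubgroup.inclusion (AcSigned.geomTorsion_zpow_le_geomPrimaryTorsion W p N)) (fun _ _ ↦ rfl) b) ∈ W.selmerInfty κ := by
  -- (1) the local exponent at `v₀`
  obtain ⟨N₀, hN₀⟩ := Rank1Residual.GaloisImage.exists_pow_smul_eq_zero_galoisCohomology_localGaloisModule W v₀ p hpv₀
  -- (2) the infinite places: finite local cohomology
  have hinfAll : ∀ w : InfinitePlace ℚ, ∃ cw : ℕ, 0 < cw ∧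
      ∀ x : galoisCohomology (W.localGaloisModule w.Completion) 1, cw • x = 0 := fun w ↦ by
    haveI := W.finite_localH1_infinitePlace w
    exact ⟨Nat.card (galoisCohomology (W.localGaloisModule w.Completion) 1), Nat.card_pos,
      fun x ↦ addOrderOf_dvd_iff_nsmul_eq_zero.mp (addOrderOf_dvd_natCard x)⟩
  choose cinf hcinf using hinfAll
  refine ⟨padicValNat p (p ^ N₀ * ∏ w : InfinitePlace ℚ, cinf w), fun N _ s hs hs1 b hunr hstrict ↦ ?_⟩
  have hA : p ^ N₀ * ∏ w : InfinitePlace ℚ, cinf w ≠ 0 :=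
    mul_ne_zero (pow_ne_zero _ hp.out.ne_zero) (Finset.prod_pos fun w _ ↦ (hcinf w).1).ne'
  have hall₀ : ∀ τ : absoluteGaloisGroup (v₀.adicCompletion ℚ), τ ∈ localSubgroup (κ.layerSubgroup n) (v₀.adicCompletion ℚ) :=
    fun τ ↦ by rw [hsplit]; exact Subgroup.mem_top τ
  -- `p^N` kills `b` and its push `y`
  have hb0 : p ^ N • b = 0 := by
    have h := H46LevelZero.zsmul_torsionH1Over_eq_zero W (p ^ N) (κ.layerSubgroup n)
    rw [Nat.cast_pow] at h
    exact h b
  have hy0 : p ^ N • resH1Hom (N := W.geomPrimaryTorsion p) (subgroupInclusion (le_refl (κ.layerSubgroup n)))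
      (AddSubgroup.inclusion (AcSigned.geomTorsion_zpow_le_geomPrimaryTorsion W p N)) (fun _ _ ↦ rfl) b = 0 := by
    rw [← map_nsmul, hb0, map_zero]
  -- `conj_σ ∘ h_n = h_n ∘ conj_σ`
  have hconj : ∀ (σ : absoluteGaloisGroup ℚ) (y : W.subgroupH1 p (κ.layerSubgroup n)),
      W.conjH1 p κ.kerSubgroup σ (W.layerToInfty κ n y) = W.layerToInfty κ n (W.conjH1 p (κ.layerSubgroup n) σ y) :=
    fun σ y ↦ (W.layerToInfty_conjH1 κ σ y).symm
  refine (W.mem_selmerGroupOver_iff p κ.kerSubgroup _).mpr ⟨fun v σ ↦ ?_, fun w σ ↦ ?_⟩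
  · rw [map_nsmul]
    by_cases hpv : ((p : ℕ) : 𝓞 ℚ) ∈ v.asIdeal
    · -- `v = vp`: Greenberg-strict ⟹ Kummer above `p` over `ℚ_∞`
      have hveq : v = vp := Rat.HeightOneSpectrum.primesEquiv.injective (Subtype.ext
        ((Rat.HeightOneSpectrum.primesEquiv_eq_of_natCast_mem v hp.out hpv).trans
          (Rat.HeightOneSpectrum.primesEquiv_eq_of_natCast_mem vp hp.out hvp).symm))
      subst hveq
      exact AddSubgroup.nsmul_mem _ (H46AtP.conjH1_realiser_mem_localKerOver_of_mem_strictKer W p κ hκ n N v hpv hgoodp b hstrict σ) _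
    · by_cases hv₀ : v = v₀
      · -- the split auxiliary place: the layer-`0` exponent argument at the layer `n`
        subst hv₀
        rw [hconj, ← map_nsmul]
        refine W.resOfLe_mem_localKerOver p (v.adicCompletion ℚ) (κ.kerSubgroup_le_layerSubgroup n) ?_
        rw [W.mem_localKerOver_iff, map_nsmul]
        have hx : p ^ N • W.localResOver p (κ.layerSubgroup n) (v.adicCompletion ℚ) (W.conjH1 p (κ.layerSubgroup n) σ
            (resH1Hom (N := W.geomPrimaryTorsion p) (subgroupInclusion (le_refl (κ.layerSubgroup n)))
              (AddSubgroup.inclusion (AcSigned.geomTorsion_zpow_le_geomPrimaryTorsion W p N)) (fun _ _ ↦ rfl) b)) = 0 := by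
          rw [← map_nsmul, ← map_nsmul, hy0, map_zero, map_zero]
        have h1 := pow_nsmul_localH1_eq_zero_of_forall_mem W p (v.adicCompletion ℚ) (κ.layerSubgroup n) hall₀ hN₀ _ hx
        refine H46LevelZero.pow_padicValNat_nsmul_eq_zero p hA ?_ hx
        rw [mul_nsmul, h1, nsmul_zero]
      · -- `v ∤ p`, `v ≠ v₀`: unramified ⟹ Kummer over `ℚ_∞` (good or bad)
        exact AddSubgroup.nsmul_mem _ (H46BadPlaces.conjH1_realiser_mem_localKerOver_of_localization_shapiroLift_mem_unramified_of_not_mem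
          W p κ hκ n N hs hs1 v hpv b (hunr v hv₀ hpv) σ) _
  · -- infinite places: the local subgroup of the layer is everything, `H¹(ℚ_w, E)` is finite
    rw [map_nsmul, hconj, ← map_nsmul]
    refine W.resOfLe_mem_localKerOver p w.Completion (κ.kerSubgroup_le_layerSubgroup n) ?_
    rw [W.mem_localKerOver_iff, map_nsmul]
    have hx : p ^ N • W.localResOver p (κ.layerSubgroup n) w.Completion (W.conjH1 p (κ.layerSubgroup n) σ
        (resH1Hom (N := W.geomPrimaryTorsion p) (subgroupInclusion (le_refl (κ.layerSubgroup n)))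
          (AddSubgroup.inclusion (AcSigned.geomTorsion_zpow_le_geomPrimaryTorsion W p N)) (fun _ _ ↦ rfl) b)) = 0 := by
      rw [← map_nsmul, ← map_nsmul, hy0, map_zero, map_zero]
    have hbij := bijective_resH1Hom_subgroupIncl (localPoints W w.Completion) (localSubgroup (κ.layerSubgroup n) w.Completion)
      (mem_localSubgroup_layerSubgroup_infinitePlace p κ n w)
    obtain ⟨y, hy⟩ := hbij.2 (W.localResOver p (κ.layerSubgroup n) w.Completion (W.conjH1 p (κ.layerSubgroup n) σ
      (resH1Hom (N := W.geomPrimaryTorsion p) (subgroupInclusion (le_refl (κ.layerSubgroup n)))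
        (AddSubgroup.inclusion (AcSigned.geomTorsion_zpow_le_geomPrimaryTorsion W p N)) (fun _ _ ↦ rfl) b)))
    obtain ⟨d, hd⟩ := Finset.dvd_prod_of_mem cinf (Finset.mem_univ w)
    have hA' : p ^ N₀ * (cinf w * d) = cinf w * (p ^ N₀ * d) := by ring
    have h0 : cinf w • ((p ^ N₀ * d) • y) = 0 := (hcinf w).2 _
    refine H46LevelZero.pow_padicValNat_nsmul_eq_zero p hA ?_ hx
    rw [← hy, ← map_nsmul, hd, hA', mul_nsmul']
    exact (congrArg _ h0).trans (map_zero _)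

end Main

end TorsionEulerChar.H46LayerSelmer

end Summit.BirchSwinnertonDyer.BirchSwinnertonDyer.Theorems

end
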